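import Summits.QuantumFields.BalabanUV.Beta.GAN24.FineReadoutDecay

/-!
# Beta / RemainderExplicitMultiplier — BINDER-OWNERS row D4, ROAD P3 (co-owner #3, unit `b2b-balaban-beta-d4-p3`), skeleton
# leaf E3.3, FIRST THIRD: THE CONSTRAINT MULTIPLIER OF THE TYPED `U = 1` KKT SOLUTION OPERATOR IS `O(N^{−(d+2)}·N^{−3})`
# POINTWISE WITH BLOCK-SCALE DECAY, LEVEL-UNIFORMLY — `|wΦ^{(N)}(y)| ≤ C · (N^5)⁻¹ · (N^3)⁻¹ · e^{−κ₀‖y‖∞}`, `N = Lc^{j+1}`, `d + 1 = 4`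

HONEST FRAMING (page 1 of everything the β sub-cell writes): discharging `BetaPertH` makes Bałaban's UV stability
UNCONDITIONAL — a real constructive-QFT result; it is NOT the continuum limit and NOT the Clay problem.  HONEST DEPENDENCY
(verbatim): «continuum YM on T⁴ ⇐ BetaPertH ∧ nine spine estimates (0/9 proved); BetaPertH ⇐ (D1) ∧ (D4) ∧ CAP+tail;
G-an2-4 gates asym, D1 and NE2/3/4.»  NOT IN PRINT; OUR PROOF.  `[folklore]` packaging of the third component of the G-an2-4
swarm's sharp-ℓ² a-priori bound `GAN24.FineReadoutApriori.column_apriori` («`‖wΦ̂_{κl}‖ = ‖fibInv N (inr (inr κ)) (inr (inr l)) p‖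
≤ (r₀²/N³)·A·(N^{d+2})⁻¹`») into a POSITION-SPACE statement about `KernelSpecInstance.wΦ`
(`CombesThomasFibre.wΦ_eq_re_latticeKernel` + Paley–Wiener), exactly as `GAN24.FineReadoutDecay.exists_wH_decay` packages the
field entry.  No cited fact, no wall binder; nothing about Bałaban's densities is asserted.  NOT summit progress.

ABSOLUTE RULE (cell charter, verbatim): "No internally-minted statement may enter as a cited fact. Every hypothesis is
either kernel-proved in this package or a verbatim quotation of a PUBLISHED theorem with page reference. The manuscript(s)
under audit are NOT citable for their own disputed steps — they are the thing under adjudication; programme-internal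
(2001/route/tribunal) claims are never citable."

## Why road P3 wants this (skeleton `HOME/beta/skeletons/D4-b2b-balaban-beta-d4-p3.md` §3 leaf E3.3; units note `UNITS-E4.md` §5)

The `|Δ^ξ_U𝐀|_X` and `|P₁𝐀|_X` components of the (3.14)/(4.4) norm of [Balaban1987RG1] pp. 272/281 for road P3's test configuration
`h = N^{d+2}·wH^{(N)}` are read through the EULER–LAGRANGE identity of the typed KKT system (`AffineReproduction`:
«`curvAdj (curv (H b)) = 𝒬ᵀ (Φ b) + dz (Ψ b)`»; [I] p. 272 «D*D + DRD* = Δ − P₁»): `(Δ − P₁)h = N^{d+2}·(𝒬ᵀ wΦ + d wM)` in fine units,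
`Δ^η = N²·Δ`, and `𝒬ᵀ` sums `N` coarse values — so a LEVEL-UNIFORM bound needs `|wΦ^{(N)}| ≲ N^{−(d+2)}·N^{−3}`.  This file proves
exactly that (the `wM` and `dd*wH` thirds are separate leaves).
-/

noncomputable section

open Complex Finset Matrix
open scoped BigOperators Real Matrix.Norms.L2Operator
open Literature.Probability.LatticeModels (TorusSite)
open Literature.MathematicalPhysics.QuantumFieldTheory.Balaban1983to89
open Literature.MathematicalPhysics.QuantumFieldTheory.Balaban1983to89.Beta
open B4Strip (Strip reVec)
open B4ContourShift (StripRegular latticeKernel supNorm latticeKernel_decay)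
open BlochFibreMatrix (stencil pieceMatrix)
open FibreInverseDecay (trigPolySymbol)
open KernelSpecInstance (wΦ)
open Summit.QuantumFields.BalabanUV.Beta.GAN24.ArrowOperator (arrowMat)
open Summit.QuantumFields.BalabanUV.Beta.GAN24.ArrowScaling (scaledArrow radI radO radI_pos radO_pos)
open Summit.QuantumFields.BalabanUV.Beta.GAN24.StripLegApriori (radO_zero_le_two_pi)
open Summit.QuantumFields.BalabanUV.Beta.GAN24.CombesThomasFibre (fibInv wΦ_eq_re_latticeKernel)
open Summit.QuantumFields.BalabanUV.Beta.GAN24.StripRegularPackaging (stripRegular_fibInv)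
open Summit.QuantumFields.BalabanUV.Beta.GAN24.FibreDetStripHolds (exists_strip strip_mono)
open Summit.QuantumFields.BalabanUV.Beta.GAN24.FineReadoutApriori (column_apriori)

namespace Summit.QuantumFields.BalabanUV.Beta.RemainderExplicitMultiplier

/-! ## §1 Packaging at generic `d` -/

section Generic

variable {d N : ℕ} [NeZero N]

/-- [folklore] THE SUP BOUND of the multiplier–multiplier entry at block side `N` and border-radius envelope `R₀`:
`phiM = R₀² · (N³)⁻¹ · A · (N^{d+2})⁻¹`. -/
def phiM (d N : ℕ) (A R0 : ℝ) : ℝ := R0 ^ 2 * ((N : ℝ) ^ 3)⁻¹ * A * ((N : ℝ) ^ (d + 1 + 1))⁻¹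

omit [NeZero N] in
/-- [folklore] `0 ≤ phiM`. -/
theorem phiM_nonneg {A R0 : ℝ} (hA : 0 ≤ A) : 0 ≤ phiM d N A R0 := by
  unfold phiM; positivity

/-- [folklore] AT A STRIP POINT WITH A SCALED A-PRIORI PAIR OF BORDER RADIUS `r₀ ≤ R₀`:
`‖fibInv N (inr (inr κ)) (inr (inr l)) p‖ ≤ phiM d N A R₀` (third component of `column_apriori`). -/
theorem norm_fibInv_inr_inr_le_phiM {A R0 : ℝ} (hA : 0 ≤ A) {p : Fin (d + 1) → ℂ}
    (hdet : (trigPolySymbol (stencil (d + 1)) (pieceMatrix (N := N)) p).det ≠ 0)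
    {r : TorusSite (d + 1) N → ℝ} (hr : ∀ m, 0 < r m) {r0 : ℝ} (hr0 : 0 < r0) (hr0R : r0 ≤ R0)
    (hU : IsUnit (arrowMat (scaledArrow N r r0 p))) (hAi : ‖(arrowMat (scaledArrow N r r0 p))⁻¹‖ ≤ A)
    (κ l : Fin (d + 1)) :
    ‖fibInv N (Sum.inr (Sum.inr κ)) (Sum.inr (Sum.inr l)) p‖ ≤ phiM d N A R0 := by
  obtain ⟨_, _, _, hφ, _⟩ := column_apriori hr hr0 p hA hdet hU hAi l
  refine (hφ κ).trans ?_
  unfold phiM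
  have hN : (0 : ℝ) < N := by exact_mod_cast Nat.pos_of_ne_zero (NeZero.ne N)
  have h2 : r0 ^ 2 ≤ R0 ^ 2 := pow_le_pow_left₀ hr0.le hr0R 2
  have hrest : 0 ≤ ((N : ℝ) ^ 3)⁻¹ * A * ((N : ℝ) ^ (d + 1 + 1))⁻¹ := by positivity
  calc r0 ^ 2 / (N : ℝ) ^ 3 * A * ((N : ℝ) ^ (d + 1 + 1))⁻¹ = r0 ^ 2 * (((N : ℝ) ^ 3)⁻¹ * A * ((N : ℝ) ^ (d + 1 + 1))⁻¹) := by
        rw [div_eq_mul_inv]; ring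
    _ ≤ R0 ^ 2 * (((N : ℝ) ^ 3)⁻¹ * A * ((N : ℝ) ^ (d + 1 + 1))⁻¹) := mul_le_mul_of_nonneg_right h2 hrest
    _ = R0 ^ 2 * ((N : ℝ) ^ 3)⁻¹ * A * ((N : ℝ) ^ (d + 1 + 1))⁻¹ := by ring

/-- [folklore] **`StripRegular` OF THE MULTIPLIER–MULTIPLIER ENTRY** from a det-free strip carrying scaled a-priori pairs (border radius `≤ R₀`). -/
theorem stripRegular_fibInv_inr_inr {κ₀ A R0 : ℝ} (hκ0 : 0 ≤ κ₀) (hA : 0 ≤ A)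
    (hdet : ∀ p ∈ Strip (d + 1) κ₀, (trigPolySymbol (stencil (d + 1)) (pieceMatrix (N := N)) p).det ≠ 0)
    (hpair : ∀ p ∈ Strip (d + 1) κ₀, ∃ (r : TorusSite (d + 1) N → ℝ) (r0 : ℝ), (∀ m, 0 < r m) ∧ 0 < r0 ∧ r0 ≤ R0 ∧
      IsUnit (arrowMat (scaledArrow N r r0 p)) ∧ ‖(arrowMat (scaledArrow N r r0 p))⁻¹‖ ≤ A)
    (κ l : Fin (d + 1)) :
    StripRegular (fibInv N (Sum.inr (Sum.inr κ)) (Sum.inr (Sum.inr l))) κ₀ (phiM d N A R0) := by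
  refine stripRegular_fibInv hκ0 hdet _ _ fun p hp => ?_
  obtain ⟨r, r0, hr, hr0, hr0R, hU, hAi⟩ := hpair p hp
  exact norm_fibInv_inr_inr_le_phiM hA (hdet p hp) hr hr0 hr0R hU hAi κ l

/-- [folklore] **THE MULTIPLIER BOUND AT BLOCK SIDE `N`** (Paley–Wiener): `|wΦ κ l y| ≤ phiM · e^{−κ₀‖y‖∞}` for every coarse site `y`. -/
theorem abs_wΦ_le {κ₀ A R0 : ℝ} (hκ0 : 0 ≤ κ₀) (hA : 0 ≤ A)
    (hdet : ∀ p ∈ Strip (d + 1) κ₀, (trigPolySymbol (stencil (d + 1)) (pieceMatrix (N := N)) p).det ≠ 0)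
    (hpair : ∀ p ∈ Strip (d + 1) κ₀, ∃ (r : TorusSite (d + 1) N → ℝ) (r0 : ℝ), (∀ m, 0 < r m) ∧ 0 < r0 ∧ r0 ≤ R0 ∧
      IsUnit (arrowMat (scaledArrow N r r0 p)) ∧ ‖(arrowMat (scaledArrow N r r0 p))⁻¹‖ ≤ A)
    (κ l : Fin (d + 1)) (y : Fin (d + 1) → ℤ) :
    |wΦ (N := N) κ l y| ≤ phiM d N A R0 * Real.exp (-(κ₀ * supNorm y)) := by
  rw [wΦ_eq_re_latticeKernel]
  refine (Complex.abs_re_le_norm _).trans ?_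
  exact latticeKernel_decay (stripRegular_fibInv_inr_inr hκ0 hA hdet hpair κ l) hκ0 _

end Generic

/-! ## §2 `d = 3`: the level-uniform multiplier bound, unconditionally, from road P1's (U1)+A -/

section Four

variable {Lc : ℕ} [NeZero Lc]

/-- [folklore] **SKELETON LEAF E3.3 (FIRST THIRD) OF ROAD P3, UNCONDITIONAL AT `d + 1 = 4`**: ONE rate `κ₀ > 0` and ONE constant `C` such
that for EVERY level `N = Lc^(j+1)`, every coarse site `y` and all directions `κ, l`,
`|wΦ (N := Lc^(j+1)) κ l y| ≤ C · ((Lc^(j+1))^5)⁻¹ · ((Lc^(j+1))^3)⁻¹ · e^{−κ₀‖y‖∞}` — the constraint multiplier of Bałaban's typed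
`U = 1` block-spin KKT system is `O(N^{−(d+2)}·N^{−3})` pointwise with exponential decay on the block scale, uniformly in the level
(inputs: `GAN24.FibreDetStripHolds.exists_strip` and `GAN24.FineReadoutApriori.column_apriori` BY NAME).  Read through road P3's units
dictionary (`h = N^5·wH`, `Δ^η = N²·Δ`, `𝒬ᵀ` sums N coarse values): the `𝒬ᵀwΦ`-part of `(Δ^η − P₁)h` is LEVEL-UNIFORMLY bounded. -/
theorem exists_wΦ_decay :
    ∃ κ₀ C : ℝ, 0 < κ₀ ∧ 0 ≤ C ∧ ∀ (j : ℕ) (κ l : Fin 4) (y : Fin 4 → ℤ),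
      |wΦ (N := Lc ^ (j + 1)) κ l y|
        ≤ C * (((Lc ^ (j + 1) : ℕ) : ℝ) ^ 5)⁻¹ * (((Lc ^ (j + 1) : ℕ) : ℝ) ^ 3)⁻¹ * Real.exp (-(κ₀ * supNorm y)) := by
  obtain ⟨ρ₀, κ₀, A, hρ₀, hκ₀, _hκρ, hκ4, hA, hdet, hpair⟩ := exists_strip (d := 3) (Lc := Lc)
  set R0 : ℝ := 2 * π with hR0
  have hR0pos : 0 < R0 := by rw [hR0]; positivity
  refine ⟨κ₀, R0 ^ 2 * A, hκ₀, by positivity, fun j κ l y => ?_⟩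
  haveI : NeZero (Lc ^ (j + 1)) := ⟨pow_ne_zero _ (NeZero.ne Lc)⟩
  have hpair₁ : ∀ p ∈ Strip (3 + 1) κ₀, ∃ (r : TorusSite (3 + 1) (Lc ^ (j + 1)) → ℝ) (r0 : ℝ), (∀ m, 0 < r m) ∧ 0 < r0 ∧ r0 ≤ R0 ∧
      IsUnit (arrowMat (scaledArrow (Lc ^ (j + 1)) r r0 p)) ∧ ‖(arrowMat (scaledArrow (Lc ^ (j + 1)) r r0 p))⁻¹‖ ≤ A := by
    intro p hp
    have hq : ∀ i, |reVec p i| ≤ π := fun i => (hp i).1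
    rcases hpair j p hp with ⟨_, hU, hAi⟩ | ⟨_, _, hq0, hU, hAi⟩
    · refine ⟨radI (Lc ^ (j + 1)), 1, radI_pos, one_pos, ?_, hU, hAi⟩
      rw [hR0]; have := Real.pi_gt_three; linarith
    · exact ⟨radO (Lc ^ (j + 1)) (reVec p), radO (Lc ^ (j + 1)) (reVec p) 0, radO_pos hq hq0, radO_pos hq hq0 0,
        radO_zero_le_two_pi hq, hU, hAi⟩
  have h := abs_wΦ_le (N := Lc ^ (j + 1)) hκ₀.le hA (hdet j) hpair₁ κ l y
  refine h.trans (le_of_eq ?_)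
  unfold phiM
  push_cast
  ring

end Four

end Summit.QuantumFields.BalabanUV.Beta.RemainderExplicitMultiplier

end
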